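import Mathlib
import Summits.ABC.ABC.Statement
import HarnessLib
import Literature.Uncategorized.ShoreyTijdeman1986Cor101

/-!
# One fixed odd-base exponent already makes the generic ω = 3 slices finite (solo-blind seat, session 5)

The generic equations of the first open support `{2, q, r}` are `2^l + q^m = rⁿ` (shape A) and `p^l + q^m = 2ⁿ`
(shape B).  `SoloBlindFixedSignature` showed (from Darmon–Granville) that each slice with BOTH odd-base exponents fixed is
finite.  Here we record the sharper classical input — Shorey, van der Poorten, Tijdeman and Schinzel (1977), in the form of
Shorey–Tijdeman, *Exponential Diophantine Equations*, Chapter 10, Corollary 10.1: for fixed non-zero `A, B` and fixed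
`n ≥ 2`, the greatest prime factor of `A x^m + B yⁿ` tends to infinity (effectively) as `max(|x|, |y|, m) → ∞` over coprime
`x, y` with `|x| > 1` and `m n ≥ 6` — as a named finiteness fact (hypothesis), and deduce that fixing ONE odd-base exponent
suffices:

* `shapeA_fixed_right_exponent_finite` : for fixed `n ≥ 2`, the `(l, m, q, r)` with `q, r` coprime, `q > 1`, `m ≥ 2`,
  `m n ≥ 6` and `2^l + q^m = rⁿ` form a finite set;
* `shapeA_fixed_left_exponent_finite`  : for fixed `m ≥ 2`, the `(l, n, q, r)` with `q, r` coprime, `q > 1`, `n ≥ 2`,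
  `m n ≥ 6` and `2^l + q^m = rⁿ` form a finite set;
* `shapeB_fixed_exponent_finite`        : for fixed `l ≥ 2`, the `(n, m, p, q)` with `p, q` coprime, `p ≥ 1`, `q > 1`,
  `m ≥ 2`, `l m ≥ 6` and `p^l + q^m = 2ⁿ` form a finite set.

So what abc asserts beyond known (even effective) theorems on these equations lives entirely in the regime where BOTH odd-base
exponents are unbounded.  (`m n ≥ 6` excludes exactly the signature `(2, 2)`, where `r - q = 2` and `c < rad`, and the linear
pencils `m = 1`, which are governed by Ridout's theorem instead.)
-/

namespace Summit.ABC.ABC.Theorems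

/-- A natural prime dividing (as an integer) a power of two is `≤ 2`. -/
private theorem prime_le_two_of_dvd_two_pow {p l : ℕ} (hp : p.Prime) (h : (p : ℤ) ∣ ((2 ^ l : ℕ) : ℤ)) : p ≤ 2 :=
  Nat.le_of_dvd two_pos (hp.dvd_of_dvd_pow (Int.natCast_dvd_natCast.mp h))

/-- **Shape A, the exponent of `r` fixed.** Given Corollary 10.1, for fixed `n ≥ 2` the solutions `(l, m, q, r)` of
`2^l + q^m = rⁿ` with `q, r` coprime, `q > 1`, `m ≥ 2`, `m n ≥ 6` form a finite set (uniformly in `m`). -/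
theorem shapeA_fixed_right_exponent_finite (hST : Literature.Uncategorized.shoreyTijdeman1986_cor_10_1) {n : ℕ} (hn : 2 ≤ n) :
    {t : ℕ × ℕ × ℕ × ℕ | Nat.Coprime t.2.2.1 t.2.2.2 ∧ 1 < t.2.2.1 ∧ 2 ≤ t.2.1 ∧ 6 ≤ t.2.1 * n ∧
      2 ^ t.1 + t.2.2.1 ^ t.2.1 = t.2.2.2 ^ n}.Finite := by
  set S := {t : ℕ × ℕ × ℕ × ℕ | Nat.Coprime t.2.2.1 t.2.2.2 ∧ 1 < t.2.2.1 ∧ 2 ≤ t.2.1 ∧ 6 ≤ t.2.1 * n ∧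
      2 ^ t.1 + t.2.2.1 ^ t.2.1 = t.2.2.2 ^ n} with hSdef
  have hF := hST (-1) 1 (by norm_num) one_ne_zero n hn 2
  -- the injection `(l, m, q, r) ↦ (q, r, m)`
  let g : ℕ × ℕ × ℕ × ℕ → ℤ × ℤ × ℕ := fun t => ((t.2.2.1 : ℤ), (t.2.2.2 : ℤ), t.2.1)
  have hg : Set.InjOn g S := by
    rintro ⟨l, m, q, r⟩ ht ⟨l', m', q', r'⟩ ht' h
    simp only [g, Prod.mk.injEq, Nat.cast_inj] at h
    obtain ⟨h1, h2, h3⟩ := h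
    subst h1; subst h2; subst h3
    obtain ⟨-, -, -, -, he⟩ := ht
    obtain ⟨-, -, -, -, he'⟩ := ht'
    have : 2 ^ l = 2 ^ l' := by simp only at he he'; omega
    have : l = l' := Nat.pow_right_injective (le_refl 2) this
    subst this; rfl
  have himg : g '' S ⊆ _ := fun _ ⟨⟨l, m, q, r⟩, ht, hx⟩ => by
    subst hx
    obtain ⟨hcop, hq1, hm, hmn, h⟩ := ht
    simp only at hcop hq1 hm hmn h
    show g (l, m, q, r) ∈ {t : ℤ × ℤ × ℕ | 1 < |t.1| ∧ t.2.1 ≠ 0 ∧ IsCoprime t.1 t.2.1 ∧ 2 ≤ t.2.2 ∧ 6 ≤ t.2.2 * n ∧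
      ∀ p : ℕ, p.Prime → (p : ℤ) ∣ (-1) * t.1 ^ t.2.2 + 1 * t.2.1 ^ n → p ≤ 2}
    simp only [g, Set.mem_setOf_eq]
    have hr : r ≠ 0 := by
      rintro rfl
      rw [zero_pow (by omega)] at h
      have := Nat.one_le_two_pow (n := l); omega
    refine ⟨?_, by exact_mod_cast hr, Nat.isCoprime_iff_coprime.mpr hcop, hm, hmn, fun p hp hdvd => ?_⟩
    · rw [abs_of_nonneg (by positivity)]; exact_mod_cast hq1
    · have key : (-1) * (q : ℤ) ^ m + 1 * (r : ℤ) ^ n = ((2 ^ l : ℕ) : ℤ) := by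
        have := congrArg (Nat.cast : ℕ → ℤ) h; push_cast at this ⊢; linarith
      exact prime_le_two_of_dvd_two_pow hp (key ▸ hdvd)
  exact Set.Finite.of_finite_image (hF.subset himg) hg

/-- **Shape A, the exponent of `q` fixed.** Given Corollary 10.1, for fixed `m ≥ 2` the solutions `(l, n, q, r)` of
`2^l + q^m = rⁿ` with `q, r` coprime, `q > 1`, `n ≥ 2`, `n m ≥ 6` form a finite set (uniformly in `n`). -/
theorem shapeA_fixed_left_exponent_finite (hST : Literature.Uncategorized.shoreyTijdeman1986_cor_10_1) {m : ℕ} (hm : 2 ≤ m) :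
    {t : ℕ × ℕ × ℕ × ℕ | Nat.Coprime t.2.2.1 t.2.2.2 ∧ 1 < t.2.2.1 ∧ 2 ≤ t.2.1 ∧ 6 ≤ t.2.1 * m ∧
      2 ^ t.1 + t.2.2.1 ^ m = t.2.2.2 ^ t.2.1}.Finite := by
  set S := {t : ℕ × ℕ × ℕ × ℕ | Nat.Coprime t.2.2.1 t.2.2.2 ∧ 1 < t.2.2.1 ∧ 2 ≤ t.2.1 ∧ 6 ≤ t.2.1 * m ∧
      2 ^ t.1 + t.2.2.1 ^ m = t.2.2.2 ^ t.2.1} with hSdef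
  have hF := hST 1 (-1) one_ne_zero (by norm_num) m hm 2
  -- the injection `(l, n, q, r) ↦ (r, q, n)`
  let g : ℕ × ℕ × ℕ × ℕ → ℤ × ℤ × ℕ := fun t => ((t.2.2.2 : ℤ), (t.2.2.1 : ℤ), t.2.1)
  have hg : Set.InjOn g S := by
    rintro ⟨l, n, q, r⟩ ht ⟨l', n', q', r'⟩ ht' h
    simp only [g, Prod.mk.injEq, Nat.cast_inj] at h
    obtain ⟨h1, h2, h3⟩ := h
    subst h1; subst h2; subst h3
    obtain ⟨-, -, -, -, he⟩ := ht
    obtain ⟨-, -, -, -, he'⟩ := ht'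
    have : 2 ^ l = 2 ^ l' := by simp only at he he'; omega
    have : l = l' := Nat.pow_right_injective (le_refl 2) this
    subst this; rfl
  have himg : g '' S ⊆ _ := fun _ ⟨⟨l, n, q, r⟩, ht, hx⟩ => by
    subst hx
    obtain ⟨hcop, hq1, hn, hnm, h⟩ := ht
    simp only at hcop hq1 hn hnm h
    show g (l, n, q, r) ∈ {t : ℤ × ℤ × ℕ | 1 < |t.1| ∧ t.2.1 ≠ 0 ∧ IsCoprime t.1 t.2.1 ∧ 2 ≤ t.2.2 ∧ 6 ≤ t.2.2 * m ∧
      ∀ p : ℕ, p.Prime → (p : ℤ) ∣ 1 * t.1 ^ t.2.2 + (-1) * t.2.1 ^ m → p ≤ 2}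
    simp only [g, Set.mem_setOf_eq]
    have hr : 1 < r := by
      by_contra hle
      have hr1 : r ≤ 1 := Nat.le_of_not_lt hle
      have h1 : r ^ n ≤ 1 := by
        calc r ^ n ≤ 1 ^ n := Nat.pow_le_pow_left hr1 n
          _ = 1 := one_pow n
      have h2 : 1 < q ^ m := Nat.one_lt_pow (by omega) hq1
      have := Nat.one_le_two_pow (n := l)
      omega
    refine ⟨?_, by exact_mod_cast (by omega : q ≠ 0), Nat.isCoprime_iff_coprime.mpr hcop.symm, hn, hnm,
      fun p hp hdvd => ?_⟩
    · rw [abs_of_nonneg (by positivity)]; exact_mod_cast hr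
    · have key : 1 * (r : ℤ) ^ n + (-1) * (q : ℤ) ^ m = ((2 ^ l : ℕ) : ℤ) := by
        have := congrArg (Nat.cast : ℕ → ℤ) h; push_cast at this ⊢; linarith
      exact prime_le_two_of_dvd_two_pow hp (key ▸ hdvd)
  exact Set.Finite.of_finite_image (hF.subset himg) hg

/-- **Shape B, the exponent of `p` fixed.** Given Corollary 10.1, for fixed `l ≥ 2` the solutions `(n, m, p, q)` of
`p^l + q^m = 2ⁿ` with `p, q` coprime, `p ≥ 1`, `q > 1`, `m ≥ 2`, `m l ≥ 6` form a finite set (uniformly in `m`). -/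
theorem shapeB_fixed_exponent_finite (hST : Literature.Uncategorized.shoreyTijdeman1986_cor_10_1) {l : ℕ} (hl : 2 ≤ l) :
    {t : ℕ × ℕ × ℕ × ℕ | Nat.Coprime t.2.2.1 t.2.2.2 ∧ 0 < t.2.2.1 ∧ 1 < t.2.2.2 ∧ 2 ≤ t.2.1 ∧ 6 ≤ t.2.1 * l ∧
      t.2.2.1 ^ l + t.2.2.2 ^ t.2.1 = 2 ^ t.1}.Finite := by
  set S := {t : ℕ × ℕ × ℕ × ℕ | Nat.Coprime t.2.2.1 t.2.2.2 ∧ 0 < t.2.2.1 ∧ 1 < t.2.2.2 ∧ 2 ≤ t.2.1 ∧ 6 ≤ t.2.1 * l ∧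
      t.2.2.1 ^ l + t.2.2.2 ^ t.2.1 = 2 ^ t.1} with hSdef
  have hF := hST 1 1 one_ne_zero one_ne_zero l hl 2
  -- the injection `(n, m, p, q) ↦ (q, p, m)`
  let g : ℕ × ℕ × ℕ × ℕ → ℤ × ℤ × ℕ := fun t => ((t.2.2.2 : ℤ), (t.2.2.1 : ℤ), t.2.1)
  have hg : Set.InjOn g S := by
    rintro ⟨n, m, p, q⟩ ht ⟨n', m', p', q'⟩ ht' h
    simp only [g, Prod.mk.injEq, Nat.cast_inj] at h
    obtain ⟨h1, h2, h3⟩ := h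
    subst h1; subst h2; subst h3
    obtain ⟨-, -, -, -, -, he⟩ := ht
    obtain ⟨-, -, -, -, -, he'⟩ := ht'
    have : 2 ^ n = 2 ^ n' := by simp only at he he'; omega
    have : n = n' := Nat.pow_right_injective (le_refl 2) this
    subst this; rfl
  have himg : g '' S ⊆ _ := fun _ ⟨⟨n, m, p, q⟩, ht, hx⟩ => by
    subst hx
    obtain ⟨hcop, hp0, hq1, hm, hml, h⟩ := ht
    simp only at hcop hp0 hq1 hm hml h
    show g (n, m, p, q) ∈ {t : ℤ × ℤ × ℕ | 1 < |t.1| ∧ t.2.1 ≠ 0 ∧ IsCoprime t.1 t.2.1 ∧ 2 ≤ t.2.2 ∧ 6 ≤ t.2.2 * l ∧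
      ∀ p : ℕ, p.Prime → (p : ℤ) ∣ 1 * t.1 ^ t.2.2 + 1 * t.2.1 ^ l → p ≤ 2}
    simp only [g, Set.mem_setOf_eq]
    refine ⟨?_, by exact_mod_cast (by omega : p ≠ 0), Nat.isCoprime_iff_coprime.mpr hcop.symm, hm, hml,
      fun p' hp' hdvd => ?_⟩
    · rw [abs_of_nonneg (by positivity)]; exact_mod_cast hq1
    · have key : 1 * (q : ℤ) ^ m + 1 * (p : ℤ) ^ l = ((2 ^ n : ℕ) : ℤ) := by
        have := congrArg (Nat.cast : ℕ → ℤ) h; push_cast at this ⊢; linarith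
      exact prime_le_two_of_dvd_two_pow hp' (key ▸ hdvd)
  exact Set.Finite.of_finite_image (hF.subset himg) hg

end Summit.ABC.ABC.Theorems
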